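import Literature.Computability.ImplicitComplexity.SoftTypeAssignmentStandard
import HarnessLib

/-!
# The leftmost-outermost strategy of `Λ₊` reaches every normal form

Continuation of `SoftTypeAssignmentStandard.lean`. For the calculus `Λ₊` of `STA₊`
(Gaboardi–Marion–Ronchi Della Rocca 2008 = GMR08, Def. 5.1–5.2) we define

* `STA.Normal M` — `M` has no `→βγ`-reduct (so a normal term is sum-free and β-normal), with its
  structural inversion lemmas, and `STA.Neutral M` — `M` is a variable applied to arguments;
* `STA.Lmo` — ONE step of the leftmost-outermost strategy with erratic choice: a weak head step
  if there is one (`STA.Hd`: head `β`, or resolving a head sum either way), otherwise descend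
  under the abstraction, otherwise into the leftmost non-normal argument of the head variable;
  `STA.LmoStar` its reflexive–transitive closure. Apart from the two ways of resolving a sum the
  strategy is deterministic (`Lmo` is the strategy followed by the machine `K_ND` of GMR08
  Table 6, on plain terms);

and prove the completeness of the strategy for normal forms,

* `lmoStar_of_reduces_normal` — if `M →βγ* N` with `N` normal then `M` reaches `N` by
  leftmost-outermost steps (for suitable choices at the sums),

which is the combinatorial content of "M can be evaluated to every one of its normal forms"
in GMR08 Lemma 5.4 / Lemma 5.7 / Thm. 5.12. It follows from standardization (`St.of_reduces`)
by the classical argument that a standard reduction to a normal form is the leftmost one. In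
particular acceptance in the sense of GMR08 Def. 5.13 (`STA.DecidesByZero`: some reduction
sequence reaches `0`) is acceptance by the leftmost strategy (`reduces_zero_iff_lmoStar`).

## References

* [GaboardiMarionRonchidellarocca2008] GMR08, Def. 5.2, §5.1 (Table 6, Lemma 5.4, Lemma 5.7,
  Thm. 5.12), Def. 5.13.
* R. Kashima, *A proof of the standardization theorem in λ-calculus*, RIMS Kôkyûroku 1217 (2001);
  H. Barendregt, *The Lambda Calculus*, North-Holland 1984, Thm. 13.2.2 (normalization of the
  leftmost strategy).
-/

namespace Literature.Computability.ImplicitComplexity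

namespace STA

/-! ### Normal and neutral terms -/

/-- `M` is `βγ`-normal: it has no `→βγ`-reduct. [cite: GaboardiMarionRonchidellarocca2008, Def. 5.2] -/
def Normal (M : Term) : Prop := ∀ N, ¬ Red M N

/-- Neutral terms `x A₁ ⋯ Aₖ`: a variable applied to (any) arguments. [folklore] -/
inductive Neutral : Term → Prop
  | var (i : ℕ) : Neutral (.var i)
  | app {M : Term} (N : Term) (h : Neutral M) : Neutral (.app M N)

/-- Variables are normal. [folklore] -/
theorem normal_var (i : ℕ) : Normal (.var i) := fun N h => by cases h

/-- The body of a normal abstraction is normal. [folklore] -/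
theorem Normal.of_lam {M : Term} (h : Normal (.lam M)) : Normal M := fun _ hN => h _ (Red.lam hN)

/-- An abstraction of a normal term is normal. [folklore] -/
theorem Normal.lam {M : Term} (h : Normal M) : Normal (.lam M) := fun N hN => by
  cases hN with
  | lam h' => exact h _ h'

/-- The function part of a normal application is normal. [folklore] -/
theorem Normal.appL {M N : Term} (h : Normal (.app M N)) : Normal M := fun _ hM => h _ (Red.appL N hM)

/-- The argument part of a normal application is normal. [folklore] -/
theorem Normal.appR {M N : Term} (h : Normal (.app M N)) : Normal N := fun _ hN => h _ (Red.appR M hN)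

/-- The function part of a normal application is not an abstraction. [folklore] -/
theorem Normal.ne_lam {M N : Term} (h : Normal (.app M N)) (B : Term) : M ≠ .lam B := fun e => by
  subst e
  exact h _ (Red.beta _ _)

/-- A sum is never normal (it is a `γ`-redex). [cite: GaboardiMarionRonchidellarocca2008, Def. 5.2] -/
theorem not_normal_sum (M N : Term) : ¬ Normal (.sum M N) := fun h => h _ (Red.choiceL _ _)

/-- `0 ≐ λxy.x` is normal. [cite: GaboardiMarionRonchidellarocca2008, §3.2] -/
theorem normal_zero : Normal zero := (Normal.lam (Normal.lam (normal_var 1)))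

/-- `1 ≐ λxy.y` is normal. [cite: GaboardiMarionRonchidellarocca2008, §3.2] -/
theorem normal_one : Normal one := (Normal.lam (Normal.lam (normal_var 0)))

/-- The function part of a normal application is neutral (its head is a variable: an abstraction
head would be a `β`-redex, a sum head a `γ`-redex). [folklore] -/
theorem Normal.neutral_of_app : ∀ {M N : Term}, Normal (.app M N) → Neutral M
  | .var i, _, _ => Neutral.var i
  | .app _ M₂, _, h => Neutral.app M₂ (Normal.neutral_of_app h.appL)
  | .lam B, _, h => absurd rfl (h.ne_lam B)
  | .sum M₁ M₂, _, h => absurd h.appL (not_normal_sum M₁ M₂)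

/-- A neutral term is not an abstraction. [folklore] -/
theorem Neutral.ne_lam {M : Term} (h : Neutral M) (B : Term) : M ≠ .lam B := by
  rintro rfl
  cases h

/-- Neutral terms have no head step. [folklore] -/
theorem Neutral.not_hd {M N : Term} (h : Neutral M) (hd : Hd M N) : False := by
  induction hd with
  | beta M N => cases h with | app _ h => cases h
  | choiceL M N => cases h
  | choiceR M N => cases h
  | appL N _ ih => cases h with | app _ h => exact ih h

/-! ### The leftmost-outermost strategy -/

/-- One leftmost-outermost step of `Λ₊` (with erratic choice at head sums): a weak head step if
possible; otherwise under the abstraction; otherwise, the head being a variable, inside the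
leftmost argument that is not yet normal. [cite: GaboardiMarionRonchidellarocca2008, §5.1 (Table 6)] -/
inductive Lmo : Term → Term → Prop
  | hd {M M' : Term} (h : Hd M M') : Lmo M M'
  | lam {M M' : Term} (h : Lmo M M') : Lmo (.lam M) (.lam M')
  | appL {M M' : Term} (N : Term) (hM : Neutral M) (h : Lmo M M') : Lmo (.app M N) (.app M' N)
  | appR {M N N' : Term} (hM : Neutral M) (hn : Normal M) (h : Lmo N N') : Lmo (.app M N) (.app M N')

/-- Finitely many leftmost-outermost steps. [folklore] -/
def LmoStar : Term → Term → Prop := Relation.ReflTransGen Lmo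

/-- A leftmost step is a `→βγ` step. [cite: GaboardiMarionRonchidellarocca2008, Def. 5.2] -/
theorem Lmo.red {M N : Term} (h : Lmo M N) : Red M N := by
  induction h with
  | hd h => exact h.red
  | lam _ ih => exact Red.lam ih
  | appL N _ _ ih => exact Red.appL N ih
  | appR _ _ _ ih => exact Red.appR _ ih

/-- From an abstraction the strategy only moves under the binder. [folklore] -/
theorem Lmo.lam_inv {B X : Term} (h : Lmo (.lam B) X) : ∃ B', X = .lam B' := by
  cases h with
  | hd h => cases h
  | lam h => exact ⟨_, rfl⟩

/-- A leftmost step from a non-abstraction lifts to the function position of an application.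
[folklore] -/
theorem Lmo.app_of_ne_lam {P P' : Term} (h : Lmo P P') (hP : ∀ B, P ≠ .lam B) (N : Term) :
    Lmo (.app P N) (.app P' N) := by
  cases h with
  | hd h => exact Lmo.hd (Hd.appL N h)
  | lam h => exact absurd rfl (hP _)
  | appL N' hM h => exact Lmo.appL N (Neutral.app N' hM) (Lmo.appL N' hM h)
  | appR hM hn h => exact Lmo.appL N (Neutral.app _ hM) (Lmo.appR hM hn h)

namespace LmoStar

/-- `LmoStar ⊆ →βγ*`. [folklore] -/
theorem reduces {M N : Term} (h : LmoStar M N) : Reduces M N := by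
  induction h with
  | refl => exact Relation.ReflTransGen.refl
  | tail _ hst ih => exact ih.tail hst.red

/-- Abstractions stay abstractions along the strategy. [folklore] -/
theorem lam_inv {B X : Term} (h : LmoStar (.lam B) X) : ∃ B', X = .lam B' := by
  induction h with
  | refl => exact ⟨B, rfl⟩
  | tail _ hst ih =>
    obtain ⟨B', rfl⟩ := ih
    exact hst.lam_inv

/-- Congruence under `λ`. [folklore] -/
theorem lam {M M' : Term} (h : LmoStar M M') : LmoStar (.lam M) (.lam M') := by
  induction h with
  | refl => exact Relation.ReflTransGen.refl
  | tail _ hst ih => exact ih.tail (Lmo.lam hst)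

/-- Lifting to the function position: a leftmost sequence that does not end in an abstraction
never passes through one, so each of its steps lifts. [folklore] -/
theorem appL {P Q : Term} (h : LmoStar P Q) (hQ : ∀ B, Q ≠ .lam B) (N : Term) :
    LmoStar (.app P N) (.app Q N) := by
  induction h using Relation.ReflTransGen.head_induction_on with
  | refl => exact Relation.ReflTransGen.refl
  | head hst hrest ih =>
    refine Relation.ReflTransGen.head (hst.app_of_ne_lam (fun B e => ?_) N) ih
    subst e
    obtain ⟨B', rfl⟩ := lam_inv (Relation.ReflTransGen.head hst hrest)
    exact hQ B' rfl

/-- Lifting to the argument of a normal neutral function part. [folklore] -/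
theorem appR {M N N' : Term} (hM : Neutral M) (hn : Normal M) (h : LmoStar N N') :
    LmoStar (.app M N) (.app M N') := by
  induction h with
  | refl => exact Relation.ReflTransGen.refl
  | tail _ hst ih => exact ih.tail (Lmo.appR hM hn hst)

end LmoStar

/-- Head steps are leftmost steps. [folklore] -/
theorem HdStar.lmoStar {M N : Term} (h : HdStar M N) : LmoStar M N := by
  induction h with
  | refl => exact Relation.ReflTransGen.refl
  | tail _ hst ih => exact ih.tail (Lmo.hd hst)

/-- A standard reduction to a NORMAL form is realised by the leftmost-outermost strategy.
[folklore] -/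
theorem St.lmoStar_of_normal {M N : Term} (h : St M N) (hN : Normal N) : LmoStar M N := by
  induction h with
  | var i hL => exact hL.lmoStar
  | lam hL _ ih => exact hL.lmoStar.trans (ih hN.of_lam).lam
  | app hL _ _ ih₁ ih₂ =>
    exact hL.lmoStar.trans
      (((ih₁ hN.appL).appL hN.ne_lam _).trans (LmoStar.appR hN.neutral_of_app hN.appL (ih₂ hN.appR)))
  | sum hL _ _ _ _ => exact absurd hN (not_normal_sum _ _)

/-- **Completeness of the leftmost-outermost strategy for normal forms** (the content of "`M` can
be evaluated to every one of its normal forms", GMR08 Lemma 5.4/5.7): if `M →βγ* N` by any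
reduction sequence and `N` is normal, then `N` is reached from `M` by leftmost-outermost steps
with suitable choices at the sums. [cite: GaboardiMarionRonchidellarocca2008, Lemma 5.4 and Lemma 5.7] -/
theorem lmoStar_of_reduces_normal {M N : Term} (h : Reduces M N) (hN : Normal N) : LmoStar M N :=
  (St.of_reduces h).lmoStar_of_normal hN

/-- `M →βγ* N` with `N` normal iff the leftmost strategy reaches `N`. [folklore] -/
theorem reduces_iff_lmoStar_of_normal {M N : Term} (hN : Normal N) : Reduces M N ↔ LmoStar M N :=
  ⟨fun h => lmoStar_of_reduces_normal h hN, LmoStar.reduces⟩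

/-- Acceptance in the sense of GMR08 Def. 5.13 (`DecidesByZero`: SOME `βγ`-sequence of `M s̲`
reaches `0`) is acceptance by the leftmost-outermost evaluator with suitable choices.
[cite: GaboardiMarionRonchidellarocca2008, Def. 5.13 with Lemma 5.4] -/
theorem reduces_zero_iff_lmoStar (M : Term) : Reduces M zero ↔ LmoStar M zero :=
  reduces_iff_lmoStar_of_normal normal_zero

end STA

end Literature.Computability.ImplicitComplexity
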